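import Literature.NumberTheory.EllipticCurves.Rank1Residual.EisensteinGoodComplement
import Literature.NumberTheory.EllipticCurves.Rank1Residual.EisensteinGoodComplementSplit
import Summits.BirchSwinnertonDyer.Rank1Residual.X1.ClassClosureN1
import HarnessLib

/-!
# Track UE (Eisenstein AS PRINTED): the conversion table of Castella–Grossi–Lee–Skinner 2022 and
# Castella–Grossi–Skinner 2025 against the census classes X1 / N1 / N1′ / N1″ / X2 / X3, in the kernel

HONEST FRAMING (cell `bsd-uniform`, run/shared/lean/pub/bsd-uniform/, seat `ue-lit`): the cell's goal is a
CONDUCTOR-FREE BSD formula for analytic rank `≤ 1` via UNIFORM class theorems that replace per-curve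
certificates. This file is the kernel form of the table in `HOME/ue/EISENSTEIN-AS-PRINTED.md` §5 for
ONE track (UE): what the two PUBLISHED Eisenstein-prime papers give UNIFORMLY and LITERALLY, and — for
each residual census class handed to this track — the printed hypothesis that fails identically on it.
THEOREMS ONLY: no definition, no named fact, no `sorry`; every deep input is one of the tree's existing
named facts, BY NAME. Nothing here is a claim toward the summit; no per-curve certificate is counted as
a uniform theorem; no label or census number is changed by this file (labels: b2b-bsdres referee;
densities: pub-bsdpct referee A).

WHAT IS PROVED UNIFORMLY (and for which reduction types): at a prime `p > 2` of GOOD reduction with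
`E[p]` reducible and `a_p ≢ 1 (mod p)` (`¬ anom(p)` ⟺ "`φ|_{G_p} ≠ 1, ω`" as printed), for every `E/ℚ`
of analytic rank `≤ 1`: `BSD(E,p)` — from Castella–Grossi–Skinner 2025 Theorem D alone
(`convertible_nonAnomalous`), and, Beilinson–Flach-free, on the sub-locus
`(r = 0 ∧ gvpar) ∨ (¬anom ∧ r = 1 ∧ ¬gvpar)` from Greenberg–Vatsal 2000 + Castella–Grossi–Lee–Skinner
2022 Theorem F (`convertible_bfFree`). WHAT RESIDUE REMAINS, EXACTLY: class X1 (anomalous: all of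
N1 / N1′ / N1″), class X2 (multiplicative `p`), class X3 (additive `p`) — on each the printed
hypotheses fail identically (`classX1_anom`, `n1_anom`, `n1'_anom`, `n1''_anom`, `classX2_not_good`,
`classX3_not_good`), so NEITHER paper converts any pair of them; their residues stay as recorded in
RESIDUAL-MAP §I (Keller–Yin PRE for N1; the per-pair Schneider certificate for N1′; Mazur's main
conjecture at type A for N1″; the missing Eisenstein analogues at `p ∣ N` for X2/X3).

WHY THIS IS NOT NEW MATHEMATICS and why it is still typed: the positive rows re-export
`Rank1Residual.bsdp_of_thmD_of_not_anom` / `bsdp_of_bfFreeLocus` (cell b2b-bsdres) in the shape the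
Uniform cell consumes (one universally quantified implication per row, no per-pair bit); the negative
rows are one-line unfoldings of the census predicates. The value is the LEDGER: a reader of
`CONVERSIONS.md` can check in the kernel that "UE: 0 conversions" is forced by the printed hypotheses,
not by a reading choice.

## Citation record (AS PRINTED = final accepted arXiv versions; verbatim statements and TeX line
## locators in HOME/ue/EISENSTEIN-AS-PRINTED.md §2; journal paginations not held)

* F. Castella, G. Grossi, J. Lee, C. Skinner, *On the anticyclotomic Iwasawa theory of rational elliptic
  curves at Eisenstein primes*, Invent. Math. **227** (2022) 517–580 = arXiv:2008.02571v2 ("Final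
  version, to appear in Invent. Math"): "Eisenstein prime" := odd prime of GOOD reduction with `E[p]`
  reducible (Introduction, TeX L195); **Theorem F = Thm. 5.3.1** (TeX L371–385 / L2601–2612):
  `p > 2` good ordinary, cyclic `p`-isogeny with kernel `𝔽_p(φ)`, `φ|_{G_p} ≠ 𝟙, ω`, `φ` (ramified ∧
  odd) ∨ (unramified ∧ even), `ord_{s=1} L(E,s) = 1` ⇒ `p`-part of BSD. Thm. 5.1.4 (L2487–2495) =
  Greenberg–Vatsal restated (rank `0`, parity (ramified ∧ even) ∨ (unramified ∧ odd), NO anomalous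
  exclusion). Tree facts: `CastellaGrossiLeeSkinner2022.thmF_padicValRat_bsd_rank_one`,
  `GreenbergVatsal2000.thm13_charIdeal_eq_of_gvPar`.
* F. Castella, G. Grossi, C. Skinner, *Mazur's main conjecture at Eisenstein primes*, Math. Ann. **393**
  (2025) 2451–2506 = arXiv:2303.04373v2 ("Final version, to appear in Mathematische Annalen"):
  **Theorem A = Thm. 7.1.1** (TeX L382–392 / L3277–3284: `p > 2` of good reduction, Eisenstein,
  `φ|_{G_p} ≠ 1, ω` ⇒ Mazur's main conjecture); **Theorem C = Cor. 6.5.4** (`p ∤ 2N`, (Heeg), (disc),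
  (spl), `φ|_{G_p} ≠ 1, ω` ⇒ Perrin-Riou's conjecture); **Theorem D** (§1.2, TeX L591–604: `E`, `p` as
  in Theorem A, `r ∈ {0,1}`, `ord_{s=1} L(E,s) = r` ⇒ `p`-part of BSD); printed proof of D via
  [CGLS22, Thm. 5.1.4] / [CGLS22, Thm. 5.3.1] with Theorem A in place of Greenberg–Vatsal; Theorem A's
  Beilinson–Flach input is the printed **Thm. 4.1.1**, "proved in [BSTW23, §5]" (Burungale–Skinner–
  Tian–Wan, *Zeta elements for elliptic curves and applications*, preprint = arXiv:2409.01350) — the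
  pub-bsdpct flag `CGS25-BST-Thm311` names the v1 numbering of the same dependence. Tree fact:
  `CastellaGrossiSkinner2025.thmD_padicValRat_bsd_rank_le_one`.
* Dictionary "`φ|_{G_p} ∉ {1, ω}` ⟺ `¬ anom(p)`" (for `2 < p`, good, reducible): tree theorems
  `Rank1Residual.not_anom_iff_cgs_of_good` / `not_anom_iff_cgs_of_mem_primesAbove`.
* Census classes: `Rank1Residual.ClassX1/ClassX2/ClassX3` (`Predicates.lean` = bsdN/HYPOTHESES.md,
  RESIDUAL-CASES §a.2); sub-partition N1 / N1′ / N1″ = `X1.TypeARankOne / TypeBRankOne /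
  TypeARankZero` (`Summits/…/Rank1Residual/X1/ClassClosureN1.lean`, RESIDUAL-MAP §I).

DENSITY NOTE (for pub-bsdpct's «66.85 % → x %»): every pair in every row below has `E[p]` reducible at
an odd `p` — a naive-height density-`0` set of curves (inside Duke 1997's non-surjective set; PERCENT-
FULL (ii).3 H-EIS) — so no UE row can move the conductor-free density; nothing in this file speaks
about densities.
-/

noncomputable section

open scoped Classical

open WeierstrassCurve Literature.NumberTheory.EllipticCurves
  Literature.NumberTheory.EllipticCurves.ModularForms
  Literature.NumberTheory.EllipticCurves.Rank1Residual

namespace Summit.BirchSwinnertonDyer.Uniform.UE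

variable {W : WeierstrassCurve ℚ} {p : ℕ} [Fact p.Prime]

/-! ## Positive rows: the uniform, literal class theorems the two papers print -/

/-- **Row C6 — UNIFORM and LITERAL (Castella–Grossi–Skinner 2025 Theorem D as printed).** For every
elliptic curve `E/ℚ` (globally minimal model `W`) and every prime `p > 2` of good reduction with `E[p]`
reducible and `a_p ≢ 1 (mod p)` (= "`φ|_{G_p} ≠ 1, ω`"), if `ord_{s=1} L(E,s) ≤ 1` then `BSD(E,p)`
(Miller). No conductor bound, no per-pair certificate, no torsion bit: the only inputs are the named
facts Theorem D (`hD`), modularity (`hmod`) and Gross–Zagier–Kolyvagin (`hGZK`). Re-export of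
`Rank1Residual.bsdp_of_thmD_of_not_anom` in the Uniform cell's one-implication shape. Tier for the
census: PUBLISHED resting on a preprint input (printed Thm. 4.1.1 ← [BSTW23, §5]) — pub-bsdpct's
"literal" column, flag `CGS25-BST-Thm311`.
[cite: CastellaGrossiSkinner2025, Theorem D (§1.2) with Theorem A's hypotheses]
[cite: Miller2011LMS, Def. 1.1] -/
theorem convertible_nonAnomalous
    (hD : CastellaGrossiSkinner2025.thmD_padicValRat_bsd_rank_le_one)
    (hmod : hasEntireLFunction_rat) (hGZK : rank_eq_analyticRank_of_analyticRank_le_one) :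
    ∀ (W : WeierstrassCurve ℚ) [W.IsElliptic] [W.IsGloballyMinimal] (p : ℕ) [Fact p.Prime],
      2 < p → Good W p → Red W p → ¬ Anom W p → W.analyticRank ≤ 1 → BSDp W p :=
  fun W _ _ p _ hp hgood hred hna hr => bsdp_of_thmD_of_not_anom hD hmod hGZK W p hp hgood hred hna hr

/-- **Row C6 ∩ (Beilinson–Flach-free locus) — UNIFORM, LITERAL and flag-free in print.** On the locus
`(r_an = 0 ∧ gvpar(p)) ∨ (¬anom(p) ∧ r_an = 1 ∧ ¬gvpar(p))` inside "`2 < p`, good, reducible":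
`BSD(E,p)` from Greenberg–Vatsal 2000 Thm. 1.3 + Greenberg LNM 1716 Thm. 4.1 (rank `0`; = CGLS22
Thm. 5.1.4) and Castella–Grossi–Lee–Skinner 2022 Theorem F = Thm. 5.3.1 (rank `1`, kernel line
(ramified ∧ odd) ∨ (unramified ∧ even)), none of which imports a Beilinson–Flach class. Re-export of
`Rank1Residual.bsdp_of_bfFreeLocus`. Census rows T-GV0 / T-CGLS-F (flag-free).
[cite: CastellaGrossiLeeSkinner2022, Theorem F = Thm. 5.3.1; Thm. 5.1.4]
[cite: GreenbergVatsal2000, Thm. (1.3)] [cite: Miller2011LMS, Def. 1.1] -/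
theorem convertible_bfFree
    (hGV : GreenbergVatsal2000.thm13_charIdeal_eq_of_gvPar) (hGr : greenberg_charValue_rankZero)
    (hF : CastellaGrossiLeeSkinner2022.thmF_padicValRat_bsd_rank_one)
    (hmod : hasEntireLFunction_rat) (hmodP : nonempty_modularParametrizationData)
    (hGZK : rank_eq_analyticRank_of_analyticRank_le_one) :
    ∀ (W : WeierstrassCurve ℚ) [W.IsElliptic] [W.IsGloballyMinimal] (p : ℕ) [Fact p.Prime],
      2 < p → Good W p → Red W p →
      ((W.analyticRank = 0 ∧ GVPar W p) ∨ (¬ Anom W p ∧ W.analyticRank = 1 ∧ ¬ GVPar W p)) →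
      BSDp W p :=
  fun W _ _ p _ hp hgood hred hloc => bsdp_of_bfFreeLocus hGV hGr hF hmod hmodP hGZK W p hp hgood hred hloc

/-! ## Negative rows: on each residual class handed to UE a printed hypothesis fails identically -/

/-- **Row X1 — NOT convertible by either paper:** every pair of class X1 is ANOMALOUS, i.e. the printed
hypothesis "`φ|_{G_p} ≠ 1, ω`" of CGLS22 Thms. C/E/F and CGS25 Thms. A/C/D is false on it (by the
dictionary `not_anom_iff_cgs_of_good`). One-line unfolding of `Rank1Residual.ClassX1`.
[cite: CastellaGrossiSkinner2025, Theorem A (hypothesis on φ)] -/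
theorem classX1_anom [W.IsGloballyMinimal] (h : ClassX1 W p) : Anom W p := h.2.2.2.1

/-- Row X1, scope form: a pair of class X1 never satisfies the printed scope
"`2 < p ∧ good(p) ∧ red(p) ∧ ¬anom(p)`" of Theorem D / Theorem F. [folklore] -/
theorem classX1_not_inScope [W.IsGloballyMinimal] (h : ClassX1 W p) :
    ¬ (2 < p ∧ Good W p ∧ Red W p ∧ ¬ Anom W p) :=
  fun hs => hs.2.2.2 (classX1_anom h)

/-- **Row N1 (= X1a ∩ {r = 1}, type A) — NOT convertible:** anomalous. [folklore] -/
theorem n1_anom [W.IsGloballyMinimal] (h : Rank1Residual.X1.TypeARankOne W p) : Anom W p :=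
  classX1_anom h.1

/-- **Row N1′ (type B, r = 1) — NOT convertible:** anomalous (its published closure is Greenberg–Vatsal
+ Kato MODULO the per-pair Schneider certificate, `X1.bsdp_of_typeBRankOne_of_schneider`, which is not
a uniform theorem). [folklore] -/
theorem n1'_anom [W.IsGloballyMinimal] (h : Rank1Residual.X1.TypeBRankOne W p) : Anom W p :=
  classX1_anom h.1

/-- **Row N1″ (type A, r = 0) — NOT convertible:** anomalous; and the Greenberg–Vatsal parity of
CGLS22 Thm. 5.1.4 fails too (`X1.not_gvPar_of_typeARankZero`). [folklore] -/
theorem n1''_anom [W.IsGloballyMinimal] (h : Rank1Residual.X1.TypeARankZero W p) : Anom W p :=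
  classX1_anom h.1

/-- Row N1″, second failing hypothesis: no Greenberg–Vatsal parity (type A is forced by the class
clause `¬(r = 0 ∧ gvpar)`), so CGLS22 Thm. 5.1.4 (= GV00 Thm. 1.3 chain) does not apply either.
[cite: CastellaGrossiLeeSkinner2022, Thm. 5.1.4 (parity hypothesis)] -/
theorem n1''_not_gvPar [W.IsGloballyMinimal] (h : Rank1Residual.X1.TypeARankZero W p) : ¬ GVPar W p :=
  Rank1Residual.X1.not_gvPar_of_typeARankZero W p h

/-- **Row X2 (Eisenstein MULTIPLICATIVE `p`) — NOT convertible:** both papers define / assume an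
Eisenstein prime to be a prime of GOOD reduction (CGLS22 Introduction L195 "odd prime of good
reduction"; CGS25 Thm. A "of good reduction", Thm. C "`p ∤ 2N`"), and multiplicative reduction at `p`
excludes good reduction at `p` (Mathlib `HasMultiplicativeReduction.not_hasGoodReduction` on the
`ℤ_p`-minimal model). [cite: CastellaGrossiSkinner2025, Theorem A (hypothesis "good reduction")] -/
theorem classX2_not_good (h : ClassX2 W p) : ¬ Good W p :=
  WeierstrassCurve.HasMultiplicativeReduction.not_hasGoodReduction (R := ℤ_[p]) h.2.2

/-- **Row X3 (Eisenstein ADDITIVE `p`) — NOT convertible:** additive reduction is by definition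
neither good nor multiplicative (`Rank1Residual.Addv`), so the printed good-reduction hypothesis
fails. [cite: CastellaGrossiSkinner2025, Theorem A (hypothesis "good reduction")] -/
theorem classX3_not_good (h : ClassX3 W p) : ¬ Good W p := h.2.1

/-- Row X2, scope form: a pair of class X2 never satisfies the printed scope
"`2 < p ∧ good(p) ∧ red(p) ∧ ¬anom(p)`" of Theorem D / Theorem F. [folklore] -/
theorem classX2_not_inScope [W.IsGloballyMinimal] (h : ClassX2 W p) :
    ¬ (2 < p ∧ Good W p ∧ Red W p ∧ ¬ Anom W p) :=
  fun hs => classX2_not_good h hs.2.1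

/-- Row X3, scope form: a pair of class X3 never satisfies the printed scope
"`2 < p ∧ good(p) ∧ red(p) ∧ ¬anom(p)`" of Theorem D / Theorem F. [folklore] -/
theorem classX3_not_inScope [W.IsGloballyMinimal] (h : ClassX3 W p) :
    ¬ (2 < p ∧ Good W p ∧ Red W p ∧ ¬ Anom W p) :=
  fun hs => classX3_not_good h hs.2.1

/-! ## The boundary is exact: inside "good Eisenstein `p > 2`, `r ≤ 1`" the printed scope of the two
papers (together with Greenberg–Vatsal) is precisely the complement of class X1 -/

/-- **Exactness of the table at good Eisenstein primes.** For `2 < p`, good, reducible: a pair is OUT of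
the printed scope of CGS25 Thm. D (`¬anom`) and of CGLS22 Thm. 5.1.4 / GV00 (`r = 0 ∧ gvpar`) iff it
is in class X1. Re-export of `Rank1Residual.classX1_iff_not_covered`. [folklore] -/
theorem classX1_iff_outOfPrintedScope [W.IsGloballyMinimal] (hp : 2 < p) (hgood : Good W p)
    (hred : Red W p) :
    ClassX1 W p ↔ ¬ (¬ Anom W p ∨ (W.analyticRank = 0 ∧ GVPar W p)) :=
  classX1_iff_not_covered hp hgood hred

/-- **The UE dichotomy (published record, rank `≤ 1`, good Eisenstein `p > 2`):** `BSD(E,p)` from the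
printed theorems, OR the pair is in class X1 — uniformly in `E`, with no per-pair input. Re-export of
`Rank1Residual.bsdp_or_classX1`. [cite: CastellaGrossiSkinner2025, Theorem D]
[cite: GreenbergVatsal2000, Thm. (1.3)] [cite: Miller2011LMS, Def. 1.1] -/
theorem bsdp_or_classX1_uniform
    (hD : CastellaGrossiSkinner2025.thmD_padicValRat_bsd_rank_le_one)
    (hGV : GreenbergVatsal2000.thm13_charIdeal_eq_of_gvPar) (hGr : greenberg_charValue_rankZero)
    (hmod : hasEntireLFunction_rat) (hmodP : nonempty_modularParametrizationData)
    (hGZK : rank_eq_analyticRank_of_analyticRank_le_one) :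
    ∀ (W : WeierstrassCurve ℚ) [W.IsElliptic] [W.IsGloballyMinimal] (p : ℕ) [Fact p.Prime],
      2 < p → Good W p → Red W p → W.analyticRank ≤ 1 → BSDp W p ∨ ClassX1 W p :=
  fun W _ _ p _ hp hgood hred hr => bsdp_or_classX1 hD hGV hGr hmod hmodP hGZK W p hp hgood hred hr

/-- **The conversion ledger of track UE in one statement** (what `CONVERSIONS.md` may quote): at a
reducible `p` handed to UE, (i) the non-anomalous good pairs are covered uniformly (given the named
facts), and (ii) every pair of X1, X2, X3 violates a printed hypothesis — so the number of census pairs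
of X1 ∪ X2 ∪ X3 converted by CGLS22/CGS25 as printed is `0`. [folklore] -/
theorem conversion_ledger
    (hD : CastellaGrossiSkinner2025.thmD_padicValRat_bsd_rank_le_one)
    (hmod : hasEntireLFunction_rat) (hGZK : rank_eq_analyticRank_of_analyticRank_le_one)
    (W : WeierstrassCurve ℚ) [W.IsElliptic] [W.IsGloballyMinimal] (p : ℕ) [Fact p.Prime]
    (hr : W.analyticRank ≤ 1) :
    (2 < p → Good W p → Red W p → ¬ Anom W p → BSDp W p) ∧
      (ClassX1 W p → ¬ (2 < p ∧ Good W p ∧ Red W p ∧ ¬ Anom W p)) ∧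
      (ClassX2 W p → ¬ (2 < p ∧ Good W p ∧ Red W p ∧ ¬ Anom W p)) ∧
      (ClassX3 W p → ¬ (2 < p ∧ Good W p ∧ Red W p ∧ ¬ Anom W p)) :=
  ⟨fun hp hgood hred hna => convertible_nonAnomalous hD hmod hGZK W p hp hgood hred hna hr,
    classX1_not_inScope, classX2_not_inScope, classX3_not_inScope⟩

end Summit.BirchSwinnertonDyer.Uniform.UE

end
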